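import Mathlib

/-!
# Route `LeeYangFibres`, support `HyperbolicityClipsParity` (stmt-Parity-14114): fibre algebra

Helper file 3/·: the bookkeeping identities behind the fibre polynomials of the clipping lemma.
For a box `[1,u]^t` of cell indices `j`, a coordinate `i`, frozen fugacities `w_k` (`k ≠ i`),
model densities `a_n` and Walsh amplitudes `θ_S`:

* `sum_filter_piFinset_prod` — the sum–product interchange on a fibre `{j : j_i = m}`;
* `fibre_mainTerm` — the main term of the `m`-th fibre coefficient factorises as
  `M a_m (α(w) + (-1)^{m+1} β(w))`, with `α = ∑_{T ⊆ U} θ_T ∏_{k ∈ U} G_T(k, w_k)`,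
  `β = ∑_{T ⊆ U} θ_{T ∪ {i}} ∏_{k ∈ U} G_T(k, w_k)`, `U = [t] ∖ {i}`, where
  `G_T(k, x) = F̃(x) = ∑ (-1)^{n+1} a_n x^n` if `k ∈ T` and `F(x) = ∑ a_n x^n` otherwise;
* `fibre_weightSum` / `prod_geomWeight_le` — `∑_{j_i = m} ∏_{k ≠ i} w_k^{j_k} = ∏_{k ≠ i} ∑_n w_k^n ≤ u^{#U} ∏ w_k`;
* elementary bounds on `F`, `F̃`, `G_T` and the node estimates `ρ(a₁/3) ≥ 1/2` for `ρ = F̃/F`;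
* `prod_G_eq_prod_rho_mul` — `∏_{k ∈ U} G_T(k, w_k) = (∏_{k ∈ T} ρ(w_k)) · ∏_{k ∈ U} F(w_k)`.

Everything is finite algebra over `ℝ`; no named facts are used.
-/

namespace Summit.Parity.GeneralizedHardyLittlewood.Theorems.HyperbolicityClipsParity

open Finset

/-! ## Sum–product interchange on a fibre of the box -/

/-- The fibre `{j ∈ ∏_k s_k : j_i = m}` of a box is the box with the `i`-th factor replaced by `{m}`. -/
theorem filter_piFinset_eq_piFinset_update {t : ℕ} (s : Fin t → Finset ℕ) (i : Fin t) {m : ℕ}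
    (hm : m ∈ s i) :
    (Fintype.piFinset s).filter (fun j => j i = m) = Fintype.piFinset (Function.update s i {m}) := by
  ext j
  simp only [Finset.mem_filter, Fintype.mem_piFinset]
  constructor
  · rintro ⟨hj, hji⟩ k
    by_cases hk : k = i
    · subst hk; rw [Function.update_self, Finset.mem_singleton]; exact hji
    · rw [Function.update_of_ne hk]; exact hj k
  · intro hj
    have hji : j i = m := by
      have := hj i; rwa [Function.update_self, Finset.mem_singleton] at this
    refine ⟨fun k => ?_, hji⟩
    by_cases hk : k = i
    · subst hk; rw [hji]; exact hm
    · have := hj k; rwa [Function.update_of_ne hk] at this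

/-- **Sum–product interchange on a fibre**:
`∑_{j ∈ ∏ s_k, j_i = m} ∏_k f_k(j_k) = f_i(m) · ∏_{k ≠ i} ∑_{n ∈ s_k} f_k(n)`. -/
theorem sum_filter_piFinset_prod {t : ℕ} (s : Fin t → Finset ℕ) (i : Fin t) {m : ℕ}
    (hm : m ∈ s i) (f : Fin t → ℕ → ℝ) :
    ∑ j ∈ (Fintype.piFinset s).filter (fun j => j i = m), ∏ k, f k (j k) =
      f i m * ∏ k ∈ Finset.univ.erase i, ∑ n ∈ s k, f k n := by
  rw [filter_piFinset_eq_piFinset_update s i hm, ← Finset.prod_univ_sum,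
    ← Finset.mul_prod_erase Finset.univ _ (Finset.mem_univ i), Function.update_self,
    Finset.sum_singleton]
  congr 1
  refine Finset.prod_congr rfl fun k hk => ?_
  rw [Function.update_of_ne (Finset.ne_of_mem_erase hk)]

/-- **The weight sum of a fibre**: `∑_{j ∈ [1,u]^t, j_i = m} ∏_{k ≠ i} w_k^{j_k} = ∏_{k ≠ i} ∑_{n=1}^u w_k^n`
for `m ∈ [1,u]`. -/
theorem fibre_weightSum {t u : ℕ} (i : Fin t) {m : ℕ} (hm : m ∈ Finset.Icc 1 u) (w : Fin t → ℝ) :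
    ∑ j ∈ (Fintype.piFinset fun _ : Fin t => Finset.Icc 1 u).filter (fun j => j i = m),
        ∏ k ∈ Finset.univ.erase i, w k ^ (j k) =
      ∏ k ∈ Finset.univ.erase i, ∑ n ∈ Finset.Icc 1 u, w k ^ n := by
  have h := sum_filter_piFinset_prod (fun _ : Fin t => Finset.Icc 1 u) i hm
    (fun k n => if k = i then 1 else w k ^ n)
  simp only [if_true] at h
  rw [one_mul] at h
  have hL : ∀ j : Fin t → ℕ, ∏ k, (if k = i then (1 : ℝ) else w k ^ (j k)) =
      ∏ k ∈ Finset.univ.erase i, w k ^ (j k) := by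
    intro j
    rw [← Finset.mul_prod_erase Finset.univ _ (Finset.mem_univ i), if_pos rfl, one_mul]
    exact Finset.prod_congr rfl fun k hk => if_neg (Finset.ne_of_mem_erase hk)
  have hR : ∏ k ∈ Finset.univ.erase i, ∑ n ∈ Finset.Icc 1 u, (if k = i then (1 : ℝ) else w k ^ n) =
      ∏ k ∈ Finset.univ.erase i, ∑ n ∈ Finset.Icc 1 u, w k ^ n :=
    Finset.prod_congr rfl fun k hk => Finset.sum_congr rfl fun n _ =>
      if_neg (Finset.ne_of_mem_erase hk)
  rw [← hR, ← h]
  exact Finset.sum_congr rfl fun j _ => (hL j).symm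

/-- `∑_{n=1}^u w^n ≤ u w` for `0 ≤ w ≤ 1`. -/
theorem geomWeight_le {u : ℕ} {w : ℝ} (hw0 : 0 ≤ w) (hw1 : w ≤ 1) :
    ∑ n ∈ Finset.Icc 1 u, w ^ n ≤ u * w := by
  calc ∑ n ∈ Finset.Icc 1 u, w ^ n ≤ ∑ _n ∈ Finset.Icc 1 u, w := by
        refine Finset.sum_le_sum fun n hn => ?_
        have h1 : 1 ≤ n := (Finset.mem_Icc.1 hn).1
        calc w ^ n ≤ w ^ 1 := pow_le_pow_of_le_one hw0 hw1 h1
          _ = w := pow_one w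
    _ = u * w := by rw [Finset.sum_const, Nat.card_Icc, nsmul_eq_mul]; push_cast; ring

/-- `∏_{k ∈ U} ∑_{n=1}^u w_k^n ≤ u^{#U} ∏_{k ∈ U} w_k` for `w_k ∈ [0,1]`. -/
theorem prod_geomWeight_le {t u : ℕ} (U : Finset (Fin t)) {w : Fin t → ℝ}
    (hw : ∀ k, 0 ≤ w k ∧ w k ≤ 1) :
    ∏ k ∈ U, ∑ n ∈ Finset.Icc 1 u, w k ^ n ≤ (u : ℝ) ^ U.card * ∏ k ∈ U, w k := by
  rw [Finset.pow_card_mul_prod]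
  exact Finset.prod_le_prod (fun k _ => Finset.sum_nonneg fun n _ => pow_nonneg (hw k).1 n)
    fun k _ => geomWeight_le (hw k).1 (hw k).2

/-! ## The main-term factorisation of a fibre coefficient -/

/-- **Main term of the `m`-th fibre coefficient.** With `U = univ.erase i` and
`G_T(k, x) = ∑_n (± or 1) a_n x^n` (sign `(-1)^{n+1}` exactly when `k ∈ T`):
`∑_{j_i = m} W_θ(j) · M ∏_k a_{j_k} · ∏_{k ∈ U} w_k^{j_k} = M a_m (α + (-1)^{m+1} β)`. -/
theorem fibre_mainTerm {t u : ℕ} (i : Fin t) {m : ℕ} (hm : m ∈ Finset.Icc 1 u)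
    (θ : Finset (Fin t) → ℝ) (a : ℕ → ℝ) (w : Fin t → ℝ) (M : ℝ) :
    ∑ j ∈ (Fintype.piFinset fun _ : Fin t => Finset.Icc 1 u).filter (fun j => j i = m),
        (∑ S : Finset (Fin t), θ S * ∏ k ∈ S, (-1 : ℝ) ^ (j k + 1)) * (M * ∏ k, a (j k)) *
          ∏ k ∈ Finset.univ.erase i, w k ^ (j k) =
      M * a m *
        ((∑ T ∈ (Finset.univ.erase i).powerset, θ T * ∏ k ∈ Finset.univ.erase i,
            ∑ n ∈ Finset.Icc 1 u, (if k ∈ T then (-1 : ℝ) ^ (n + 1) else 1) * a n * w k ^ n) +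
         (-1 : ℝ) ^ (m + 1) *
          ∑ T ∈ (Finset.univ.erase i).powerset, θ (insert i T) * ∏ k ∈ Finset.univ.erase i,
            ∑ n ∈ Finset.Icc 1 u, (if k ∈ T then (-1 : ℝ) ^ (n + 1) else 1) * a n * w k ^ n) := by
  classical
  -- Step 1: for each `S`, the inner fibre sum factorises.
  have hS : ∀ S : Finset (Fin t),
      ∑ j ∈ (Fintype.piFinset fun _ : Fin t => Finset.Icc 1 u).filter (fun j => j i = m),
          (∏ k ∈ S, (-1 : ℝ) ^ (j k + 1)) * (M * ∏ k, a (j k)) *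
            ∏ k ∈ Finset.univ.erase i, w k ^ (j k) =
        M * ((if i ∈ S then (-1 : ℝ) ^ (m + 1) else 1) * a m) *
          ∏ k ∈ Finset.univ.erase i, ∑ n ∈ Finset.Icc 1 u,
            (if k ∈ S then (-1 : ℝ) ^ (n + 1) else 1) * a n * w k ^ n := by
    intro S
    let f : Fin t → ℕ → ℝ := fun k n =>
      (if k ∈ S then (-1 : ℝ) ^ (n + 1) else 1) * a n * (if k = i then 1 else w k ^ n)
    have key := sum_filter_piFinset_prod (fun _ : Fin t => Finset.Icc 1 u) i hm f
    have hfi : f i m = (if i ∈ S then (-1 : ℝ) ^ (m + 1) else 1) * a m := by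
      simp [f]
    have hfk : ∀ k ∈ Finset.univ.erase i, ∀ n,
        f k n = (if k ∈ S then (-1 : ℝ) ^ (n + 1) else 1) * a n * w k ^ n := by
      intro k hk n
      simp [f, Finset.ne_of_mem_erase hk]
    have hprod : ∀ j : Fin t → ℕ, ∏ k, f k (j k) =
        (∏ k ∈ S, (-1 : ℝ) ^ (j k + 1)) * (∏ k, a (j k)) * ∏ k ∈ Finset.univ.erase i, w k ^ (j k) := by
      intro j
      simp only [f, Finset.prod_mul_distrib]
      congr 1
      · congr 1
        rw [Finset.prod_ite_mem, Finset.univ_inter]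
      · rw [← Finset.mul_prod_erase Finset.univ _ (Finset.mem_univ i), if_pos rfl, one_mul]
        exact Finset.prod_congr rfl fun k hk => if_neg (Finset.ne_of_mem_erase hk)
    rw [hfi, Finset.prod_congr rfl fun k hk => Finset.sum_congr rfl fun n _ => (hfk k hk n)] at key
    calc ∑ j ∈ (Fintype.piFinset fun _ : Fin t => Finset.Icc 1 u).filter (fun j => j i = m),
          (∏ k ∈ S, (-1 : ℝ) ^ (j k + 1)) * (M * ∏ k, a (j k)) *
            ∏ k ∈ Finset.univ.erase i, w k ^ (j k)
        = ∑ j ∈ (Fintype.piFinset fun _ : Fin t => Finset.Icc 1 u).filter (fun j => j i = m),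
            M * ∏ k, f k (j k) := Finset.sum_congr rfl fun j _ => by rw [hprod]; ring
      _ = M * ((if i ∈ S then (-1 : ℝ) ^ (m + 1) else 1) * a m *
            ∏ k ∈ Finset.univ.erase i, ∑ n ∈ Finset.Icc 1 u,
              (if k ∈ S then (-1 : ℝ) ^ (n + 1) else 1) * a n * w k ^ n) := by
          rw [← Finset.mul_sum, key]
      _ = _ := by ring
  -- Step 2: swap the sums over `j` and `S`.
  have hswap : ∑ j ∈ (Fintype.piFinset fun _ : Fin t => Finset.Icc 1 u).filter (fun j => j i = m),
        (∑ S : Finset (Fin t), θ S * ∏ k ∈ S, (-1 : ℝ) ^ (j k + 1)) *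
        (M * ∏ k, a (j k)) * ∏ k ∈ Finset.univ.erase i, w k ^ (j k) =
      ∑ S : Finset (Fin t), θ S * (M * ((if i ∈ S then (-1 : ℝ) ^ (m + 1) else 1) * a m) *
          ∏ k ∈ Finset.univ.erase i, ∑ n ∈ Finset.Icc 1 u,
            (if k ∈ S then (-1 : ℝ) ^ (n + 1) else 1) * a n * w k ^ n) := by
    simp_rw [← hS, Finset.mul_sum, Finset.sum_mul]
    rw [Finset.sum_comm]
    refine Finset.sum_congr rfl fun S _ => Finset.sum_congr rfl fun j _ => ?_
    ring
  rw [hswap]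
  -- Step 3: split `S` according to `i ∈ S`: `univ = (insert i U).powerset`.
  have huniv : (Finset.univ : Finset (Finset (Fin t))) = (insert i (Finset.univ.erase i)).powerset := by
    rw [Finset.insert_erase (Finset.mem_univ i), Finset.powerset_univ]
  have hiU : i ∉ Finset.univ.erase i := Finset.notMem_erase i _
  rw [huniv, Finset.sum_powerset_insert hiU]
  have h1 : ∀ T ∈ (Finset.univ.erase i).powerset,
      θ T * (M * ((if i ∈ T then (-1 : ℝ) ^ (m + 1) else 1) * a m) *
      ∏ k ∈ Finset.univ.erase i, ∑ n ∈ Finset.Icc 1 u,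
        (if k ∈ T then (-1 : ℝ) ^ (n + 1) else 1) * a n * w k ^ n) =
      M * a m * (θ T * ∏ k ∈ Finset.univ.erase i, ∑ n ∈ Finset.Icc 1 u,
        (if k ∈ T then (-1 : ℝ) ^ (n + 1) else 1) * a n * w k ^ n) := by
    intro T hT
    have hiT : i ∉ T := fun h => hiU (Finset.mem_powerset.1 hT h)
    rw [if_neg hiT]; ring
  have h2 : ∀ T ∈ (Finset.univ.erase i).powerset, θ (insert i T) *
      (M * ((if i ∈ insert i T then (-1 : ℝ) ^ (m + 1) else 1) * a m) *
        ∏ k ∈ Finset.univ.erase i, ∑ n ∈ Finset.Icc 1 u,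
          (if k ∈ insert i T then (-1 : ℝ) ^ (n + 1) else 1) * a n * w k ^ n) =
      M * a m * ((-1 : ℝ) ^ (m + 1) * (θ (insert i T) * ∏ k ∈ Finset.univ.erase i,
        ∑ n ∈ Finset.Icc 1 u, (if k ∈ T then (-1 : ℝ) ^ (n + 1) else 1) * a n * w k ^ n)) := by
    intro T _
    rw [if_pos (Finset.mem_insert_self i T)]
    have : ∀ k ∈ Finset.univ.erase i, (∑ n ∈ Finset.Icc 1 u,
        (if k ∈ insert i T then (-1 : ℝ) ^ (n + 1) else 1) * a n * w k ^ n) =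
        ∑ n ∈ Finset.Icc 1 u, (if k ∈ T then (-1 : ℝ) ^ (n + 1) else 1) * a n * w k ^ n := by
      intro k hk
      have hki : k ≠ i := Finset.ne_of_mem_erase hk
      simp [Finset.mem_insert, hki]
    rw [Finset.prod_congr rfl this]; ring
  rw [Finset.sum_congr rfl h1, Finset.sum_congr rfl h2, ← Finset.mul_sum, ← Finset.mul_sum,
    ← Finset.mul_sum, ← mul_add]

/-! ## The generating functions `F`, `F̃`, `G_T` of the model densities -/

/-- `G_T(k, x) = F̃(x)` for `k ∈ T`. -/
theorem G_of_mem {t u : ℕ} {T : Finset (Fin t)} {k : Fin t} (hk : k ∈ T) (a : ℕ → ℝ) (x : ℝ) :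
    ∑ n ∈ Finset.Icc 1 u, (if k ∈ T then (-1 : ℝ) ^ (n + 1) else 1) * a n * x ^ n =
      ∑ n ∈ Finset.Icc 1 u, (-1 : ℝ) ^ (n + 1) * a n * x ^ n :=
  Finset.sum_congr rfl fun n _ => by rw [if_pos hk]

/-- `G_T(k, x) = F(x)` for `k ∉ T`. -/
theorem G_of_not_mem {t u : ℕ} {T : Finset (Fin t)} {k : Fin t} (hk : k ∉ T) (a : ℕ → ℝ) (x : ℝ) :
    ∑ n ∈ Finset.Icc 1 u, (if k ∈ T then (-1 : ℝ) ^ (n + 1) else 1) * a n * x ^ n =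
      ∑ n ∈ Finset.Icc 1 u, a n * x ^ n :=
  Finset.sum_congr rfl fun n _ => by rw [if_neg hk, one_mul]

/-- `|G_T(k, x)| ≤ F(x)` for `a ≥ 0`, `x ≥ 0`. -/
theorem abs_G_le_F {t u : ℕ} (T : Finset (Fin t)) (k : Fin t) {a : ℕ → ℝ} (ha : ∀ n, 0 ≤ a n)
    {x : ℝ} (hx : 0 ≤ x) :
    |∑ n ∈ Finset.Icc 1 u, (if k ∈ T then (-1 : ℝ) ^ (n + 1) else 1) * a n * x ^ n| ≤
      ∑ n ∈ Finset.Icc 1 u, a n * x ^ n := by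
  refine (Finset.abs_sum_le_sum_abs _ _).trans (Finset.sum_le_sum fun n _ => ?_)
  rw [abs_mul, abs_mul, abs_of_nonneg (ha n), abs_of_nonneg (pow_nonneg hx n)]
  have : |(if k ∈ T then (-1 : ℝ) ^ (n + 1) else 1)| = 1 := by
    split_ifs <;> simp
  rw [this, one_mul]

/-- `|F̃(x)| ≤ F(x)` for `a ≥ 0`, `x ≥ 0`. -/
theorem abs_Ftilde_le_F {u : ℕ} {a : ℕ → ℝ} (ha : ∀ n, 0 ≤ a n) {x : ℝ} (hx : 0 ≤ x) :
    |∑ n ∈ Finset.Icc 1 u, (-1 : ℝ) ^ (n + 1) * a n * x ^ n| ≤ ∑ n ∈ Finset.Icc 1 u, a n * x ^ n := by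
  refine (Finset.abs_sum_le_sum_abs _ _).trans (Finset.sum_le_sum fun n _ => ?_)
  rw [abs_mul, abs_mul, abs_of_nonneg (ha n), abs_of_nonneg (pow_nonneg hx n)]
  simp

/-- `F(x) ≥ a₁ x` for `a ≥ 0`, `x ≥ 0`, `u ≥ 1`. -/
theorem a_one_mul_le_F {u : ℕ} (hu : 1 ≤ u) {a : ℕ → ℝ} (ha : ∀ n, 0 ≤ a n) {x : ℝ} (hx : 0 ≤ x) :
    a 1 * x ≤ ∑ n ∈ Finset.Icc 1 u, a n * x ^ n := by
  have h1 : (1 : ℕ) ∈ Finset.Icc 1 u := Finset.mem_Icc.2 ⟨le_rfl, hu⟩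
  have := Finset.single_le_sum (f := fun n => a n * x ^ n)
    (fun n _ => mul_nonneg (ha n) (pow_nonneg hx n)) h1
  simpa using this

/-- Splitting off the first term: `F(x) = a₁ x + ∑_{n=2}^u a_n x^n` (`u ≥ 1`). -/
theorem F_eq_first_add {u : ℕ} (hu : 1 ≤ u) (b : ℕ → ℝ) :
    ∑ n ∈ Finset.Icc 1 u, b n = b 1 + ∑ n ∈ Finset.Icc 2 u, b n := by
  rw [← Finset.insert_Icc_add_one_left_eq_Icc hu, Finset.sum_insert (by simp)]
  rfl

/-- The tail is quadratically small: `|∑_{n=2}^u c_n a_n x^n| ≤ x² ∑_{n=1}^u a_n` for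
`|c_n| ≤ 1`, `a ≥ 0`, `0 ≤ x ≤ 1`. -/
theorem abs_tail_le {u : ℕ} {a : ℕ → ℝ} (ha : ∀ n, 0 ≤ a n) {x : ℝ} (hx0 : 0 ≤ x) (hx1 : x ≤ 1)
    (c : ℕ → ℝ) (hc : ∀ n, |c n| ≤ 1) :
    |∑ n ∈ Finset.Icc 2 u, c n * a n * x ^ n| ≤ x ^ 2 * ∑ n ∈ Finset.Icc 1 u, a n := by
  calc |∑ n ∈ Finset.Icc 2 u, c n * a n * x ^ n|
      ≤ ∑ n ∈ Finset.Icc 2 u, |c n * a n * x ^ n| := Finset.abs_sum_le_sum_abs _ _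
    _ ≤ ∑ n ∈ Finset.Icc 2 u, x ^ 2 * a n := by
        refine Finset.sum_le_sum fun n hn => ?_
        have h2 : 2 ≤ n := (Finset.mem_Icc.1 hn).1
        rw [abs_mul, abs_mul, abs_of_nonneg (ha n), abs_of_nonneg (pow_nonneg hx0 n)]
        have hxn : x ^ n ≤ x ^ 2 := pow_le_pow_of_le_one hx0 hx1 h2
        calc |c n| * a n * x ^ n ≤ 1 * a n * x ^ 2 :=
              mul_le_mul (mul_le_mul_of_nonneg_right (hc n) (ha n)) hxn (pow_nonneg hx0 n)
                (by rw [one_mul]; exact ha n)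
          _ = x ^ 2 * a n := by ring
    _ = x ^ 2 * ∑ n ∈ Finset.Icc 2 u, a n := by rw [Finset.mul_sum]
    _ ≤ x ^ 2 * ∑ n ∈ Finset.Icc 1 u, a n := by
        refine mul_le_mul_of_nonneg_left ?_ (sq_nonneg x)
        refine Finset.sum_le_sum_of_subset_of_nonneg (fun n hn => ?_) fun n _ _ => ha n
        rw [Finset.mem_Icc] at hn ⊢; omega

/-- **The node `w₀ = a₁/3`.** If `a ≥ 0`, `0 < a₁`, `∑_{n=1}^u a_n ≤ 1` and `u ≥ 1`, then at
`x = a₁/3` we have `0 < F(x)` and `F(x) ≤ 2 F̃(x)`, i.e. `ρ(x) = F̃(x)/F(x) ≥ 1/2`. -/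
theorem node_estimate {u : ℕ} (hu : 1 ≤ u) {a : ℕ → ℝ} (ha : ∀ n, 0 ≤ a n) (ha1 : 0 < a 1)
    (hsum : ∑ n ∈ Finset.Icc 1 u, a n ≤ 1) :
    0 < ∑ n ∈ Finset.Icc 1 u, a n * (a 1 / 3) ^ n ∧
      ∑ n ∈ Finset.Icc 1 u, a n * (a 1 / 3) ^ n ≤
        2 * ∑ n ∈ Finset.Icc 1 u, (-1 : ℝ) ^ (n + 1) * a n * (a 1 / 3) ^ n := by
  set x : ℝ := a 1 / 3 with hx
  have hx0 : 0 ≤ x := by rw [hx]; positivity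
  have ha1le : a 1 ≤ 1 := by
    have := Finset.single_le_sum (f := a) (fun n _ => ha n)
      (Finset.mem_Icc.2 ⟨le_refl 1, hu⟩)
    exact this.trans hsum
  have hx1 : x ≤ 1 := by rw [hx]; linarith
  have hF : ∑ n ∈ Finset.Icc 1 u, a n * x ^ n =
      a 1 * x + ∑ n ∈ Finset.Icc 2 u, (1 : ℝ) * a n * x ^ n := by
    rw [F_eq_first_add hu]; simp
  have hFt : ∑ n ∈ Finset.Icc 1 u, (-1 : ℝ) ^ (n + 1) * a n * x ^ n =
      a 1 * x + ∑ n ∈ Finset.Icc 2 u, (-1 : ℝ) ^ (n + 1) * a n * x ^ n := by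
    rw [F_eq_first_add hu (fun n => (-1 : ℝ) ^ (n + 1) * a n * x ^ n)]; norm_num
  have hT1 := abs_tail_le (u := u) ha hx0 hx1 (fun _ => (1 : ℝ)) (fun n => by simp)
  have hT2 := abs_tail_le (u := u) ha hx0 hx1 (fun n => (-1 : ℝ) ^ (n + 1)) (fun n => by simp)
  have hx2 : x ^ 2 * ∑ n ∈ Finset.Icc 1 u, a n ≤ x ^ 2 := by
    have := mul_le_mul_of_nonneg_left hsum (sq_nonneg x); simpa using this
  rw [abs_le] at hT1 hT2
  have hax : a 1 * x = 3 * x ^ 2 := by rw [hx]; ring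
  have hxpos : 0 < x := by rw [hx]; positivity
  constructor
  · rw [hF]; nlinarith [hT1.1, sq_nonneg x, hxpos]
  · rw [hF, hFt]; nlinarith [hT1.2, hT2.1]

/-- **Division by the fibre scale.** If `F(w_k) ≠ 0` on `U` and `ρ_k F(w_k) = F̃(w_k)`, then for
`T ⊆ U`: `∏_{k ∈ U} G_T(k, w_k) = (∏_{k ∈ T} ρ_k) · ∏_{k ∈ U} F(w_k)`. -/
theorem prod_G_eq_prod_rho_mul {t u : ℕ} (U T : Finset (Fin t)) (hTU : T ⊆ U) (a : ℕ → ℝ)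
    (w ρ : Fin t → ℝ)
    (hρ : ∀ k ∈ U, ρ k * ∑ n ∈ Finset.Icc 1 u, a n * w k ^ n =
      ∑ n ∈ Finset.Icc 1 u, (-1 : ℝ) ^ (n + 1) * a n * w k ^ n) :
    ∏ k ∈ U, ∑ n ∈ Finset.Icc 1 u, (if k ∈ T then (-1 : ℝ) ^ (n + 1) else 1) * a n * w k ^ n =
      (∏ k ∈ T, ρ k) * ∏ k ∈ U, ∑ n ∈ Finset.Icc 1 u, a n * w k ^ n := by
  have h : ∀ k ∈ U, (∑ n ∈ Finset.Icc 1 u, (if k ∈ T then (-1 : ℝ) ^ (n + 1) else 1) * a n * w k ^ n)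
      = (if k ∈ T then ρ k else 1) * ∑ n ∈ Finset.Icc 1 u, a n * w k ^ n := by
    intro k hk
    by_cases hkT : k ∈ T
    · rw [G_of_mem hkT, if_pos hkT, hρ k hk]
    · rw [G_of_not_mem hkT, if_neg hkT, one_mul]
  rw [Finset.prod_congr rfl h, Finset.prod_mul_distrib, Finset.prod_ite_mem,
    Finset.inter_eq_right.2 hTU]

end Summit.Parity.GeneralizedHardyLittlewood.Theorems.HyperbolicityClipsParity
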